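import Mathlib.RingTheory.Derivation.Basic
import Mathlib.Algebra.MvPolynomial.PDeriv
import Mathlib.LinearAlgebra.Matrix.Nondegenerate
import Mathlib.FieldTheory.IntermediateField.Basic
import Literature.NumberTheory.Transcendental.ZilberField
import Literature.NumberTheory.Transcendental.EclPregeometry
import HarnessLib

/-!
# Kirby's exponential derivations and the closure operator `cl` (= `ecl`)

Trunk T-TRANSCEND (`Literature/NumberTheory/Transcendental`). Support for the named fact
`Literature.NumberTheory.Transcendental.kirby_weakSchanuel_ecl_empty` (`KirbyWeakSchanuel.lean`) and for the facts of
`EclPregeometry.lean`: the derivation side of J. Kirby, *Exponential algebraicity in exponential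
fields*, Bull. Lond. Math. Soc. 42 (2010) 879–890 (arXiv:0810.4285), §4 and §7.

Kirby proves Theorem 1.2 (the weak Schanuel property over `ecl`-closed sets) as follows
(ibid. p. 11: "Theorem 1.1 is established, and theorem 1.2 follows from corollary 5.2"):

* **Def. 4.1** An *E-derivation* of an exponential field `K` is a derivation `∂` with
  `∂(exp a) = exp a · ∂a`.
* **Def. 4.3** `cl(C) = {a | ∂a = 0 for every E-derivation ∂ vanishing on C}` (here `Literature.dcl C`).
* **Lemma 4.4** `cl` is a closure operator and `cl C` is an E-subfield.
* **Prop. 4.7** `ecl C ⊆ cl C` (Jacobian argument) — PROVED here (`Literature.NumberTheory.Transcendental.ecl_subset_dcl`).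
* **Prop. 7.1** `cl C ⊆ ecl C` (the hard direction: strong extensions §5, extending derivations
  Thm. 6.3, Ax's theorem) — vendored as the named fact `Literature.NumberTheory.Transcendental.Kirby2010_dcl_subset_ecl`.
* **Thm. 5.1** (= Ax 1971, Thm. 3) and **Cor. 5.2**: for `cl`-closed `C`,
  `td(x̄, exp x̄/C) - ldim_ℚ(x̄/C) ≥ dim(x̄/C) ≥ 0` (Ax's theorem with `Δ = EDer(K/C)`).

Together with Prop. 4.7, Prop. 7.1 gives `ecl = cl` (Thm. 1.1), whence `ecl C` is `ecl`-closed
and an E-subfield: the facts `Kirby2010_ecl_idem`, `Kirby2010_ecl_isExpSubfield` of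
`EclPregeometry.lean` are DERIVED here from `Kirby2010_dcl_subset_ecl`.

## Contents

* `Literature.NumberTheory.Transcendental.derivation_mvPolynomial_aeval`: chain rule `D (aeval z f) = ∑ᵢ (∂ᵢf)(z) • D (zᵢ)` for a
  derivation and a multivariate polynomial (Mathlib has the one-variable `Derivation.map_aeval`).
* `Literature.IsEDerivation D`, `Literature.eDer C` (the `K`-submodule `EDer(K/C)`), `Literature.dcl C` (Kirby's `cl`;
  named `dcl` — "derivation closure" — because `cl` is too generic a name for the `Literature` namespace).
* `Literature.NumberTheory.Transcendental.subset_dcl`, `Literature.NumberTheory.Transcendental.dcl_mono`, `Literature.NumberTheory.Transcendental.dcl_dcl` (closure operator), `Literature.NumberTheory.Transcendental.dclSubfield`,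
  `Literature.NumberTheory.Transcendental.exp_mem_dcl` (Lemma 4.4), `Literature.NumberTheory.Transcendental.ecl_subset_dcl` (Prop. 4.7).
* Named fact `Literature.Kirby2010_dcl_subset_ecl K` (Prop. 7.1) and its consequences `ecl C = dcl C`,
  `Kirby2010_ecl_idem K`, `Kirby2010_ecl_isExpSubfield K`.

## Design

* Derivations are Mathlib's `Derivation ℤ K K` (additive Leibniz maps `K → K`), as in
  `AxSchanuel.lean`.
* On the identification of Kirby's `ecl` (Khovanskii systems of *exponential polynomials* over the
  E-subring generated by `C`, Def. 3.1–3.2) with `Literature.NumberTheory.Transcendental.ecl` (Khovanskii systems of ordinary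
  polynomials in `(x, eˣ)` over `Subring.closure C`, `ZilberField.lean`): a system of the second
  kind is one of the first kind; conversely every exponential-polynomial system becomes a
  polynomial one after adjoining one variable per `exp`-subterm (with the equation defining it),
  the new Jacobian being the old one up to a unitriangular block (Schur complement). So Prop. 7.1
  for `Literature.NumberTheory.Transcendental.ecl` is Kirby's statement verbatim; Prop. 4.7 is proved directly for `Literature.NumberTheory.Transcendental.ecl`.

## References

* J. Kirby, *Exponential algebraicity in exponential fields*, Bull. Lond. Math. Soc. 42 (2010),
  879–890, arXiv:0810.4285: Def. 4.1, Def. 4.3, Lemma 4.4, Lemma 4.6, Prop. 4.7, Thm. 5.1,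
  Cor. 5.2, Prop. 7.1, Thm. 1.1.
* J. Ax, *On Schanuel's conjectures*, Ann. of Math. 93 (1971), 252–268, Thm. 3.
-/

noncomputable section

open MvPolynomial

namespace Literature.NumberTheory.Transcendental

/-! ### Chain rule for derivations and multivariate polynomials -/

section ChainRule

variable {R A M σ : Type*} [CommRing R] [CommRing A] [Algebra R A] [AddCommGroup M]
  [Module A M] [Module R M] [Fintype σ]

/-- Chain rule: an `R`-derivation `D : A → M` applied to the value of a polynomial
`f ∈ R[X_σ]` at `z : σ → A` is `∑ᵢ (∂f/∂Xᵢ)(z) • D(zᵢ)` (Kirby 2010, Lemma 4.6: "the relations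
`∑ ∂f/∂Xᵢ(r̄) drᵢ = 0` follow from the axioms of derivations by the chain rule"). Mathlib has
the one-variable case `Derivation.map_aeval`. [cite: Kirby2010, Lemma 4.6] -/
theorem derivation_mvPolynomial_aeval (D : Derivation R A M) (z : σ → A)
    (f : MvPolynomial σ R) : D (aeval z f) = ∑ i, aeval z (pderiv i f) • D (z i) := by
  classical
  induction f using MvPolynomial.induction_on with
  | C a => simp
  | add p q hp hq => simp [hp, hq, Finset.sum_add_distrib, add_smul]
  | mul_X p i hp =>
    simp only [map_mul, aeval_X, Derivation.leibniz, hp, pderiv_X, smul_eq_mul, map_add,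
      Finset.smul_sum, smul_smul, add_smul, Finset.sum_add_distrib]
    congr 1
    · rw [Finset.sum_eq_single i]
      · simp
      · intro j _ hji
        simp [hji]
      · intro hi
        exact absurd (Finset.mem_univ i) hi

end ChainRule

/-! ### E-derivations and the closure operator `dcl` (Kirby's `cl`) -/

section EDerivation

variable {K : Type*} [Field K] [Literature.ModelTheory.ExponentialFields.ExponentialRing K]

/-- An **exponential derivation** (E-derivation) of an exponential field `K` (Kirby 2010,
Def. 4.1): a derivation `∂ : K → K` (additive, Leibniz) with `∂(exp a) = exp a · ∂a` for all `a`.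
[cite: Kirby2010, Def. 4.1] -/
def IsEDerivation (D : Derivation ℤ K K) : Prop :=
  ∀ a : K, D (Literature.ModelTheory.ExponentialFields.ExponentialRing.exp a) = Literature.ModelTheory.ExponentialFields.ExponentialRing.exp a * D a

/-- Unfolding lemma for `IsEDerivation`. [cite: Kirby2010, Def. 4.1] -/
theorem isEDerivation_iff (D : Derivation ℤ K K) :
    IsEDerivation D ↔ ∀ a : K, D (Literature.ModelTheory.ExponentialFields.ExponentialRing.exp a) = Literature.ModelTheory.ExponentialFields.ExponentialRing.exp a * D a :=
  Iff.rfl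

variable (K) in
/-- `EDer(K/C)`: the E-derivations of `K` vanishing on `C ⊆ K`, a `K`-submodule of all
derivations (Kirby 2010, Def. 4.1: "It is easy to see that these are `R`-modules").
[cite: Kirby2010, Def. 4.1] -/
def eDer (C : Set K) : Submodule K (Derivation ℤ K K) where
  carrier := {D | IsEDerivation D ∧ ∀ c ∈ C, D c = 0}
  zero_mem' := ⟨fun a => by simp, fun c _ => by simp⟩
  add_mem' {D D'} hD hD' :=
    ⟨fun a => by rw [Derivation.add_apply, hD.1 a, hD'.1 a, Derivation.add_apply, mul_add],
      fun c hc => by rw [Derivation.add_apply, hD.2 c hc, hD'.2 c hc, add_zero]⟩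
  smul_mem' r {D} hD :=
    ⟨fun a => by rw [Derivation.smul_apply, hD.1 a, Derivation.smul_apply, smul_eq_mul,
        smul_eq_mul, mul_left_comm],
      fun c hc => by rw [Derivation.smul_apply, hD.2 c hc, smul_zero]⟩

/-- Membership in `eDer K C`. [cite: Kirby2010, Def. 4.1] -/
@[simp] theorem mem_eDer_iff {C : Set K} {D : Derivation ℤ K K} :
    D ∈ eDer K C ↔ IsEDerivation D ∧ ∀ c ∈ C, D c = 0 :=
  Iff.rfl

/-- `EDer(K/C)` is antitone in `C`. [cite: Kirby2010, Def. 4.1] -/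
theorem eDer_antitone {B C : Set K} (h : B ⊆ C) : eDer K C ≤ eDer K B :=
  fun _ hD => ⟨hD.1, fun c hc => hD.2 c (h hc)⟩

/-- **Kirby's closure operator `cl`** (Kirby 2010, Def. 4.3), here `dcl` ("derivation
closure"): `a ∈ dcl C` iff `∂a = 0` for every E-derivation `∂` of `K` vanishing on `C`.
By Kirby's Thm. 1.1 it coincides with the exponential-algebraic closure `ecl C`
(`ecl_subset_dcl` below and the fact `Kirby2010_dcl_subset_ecl`). [cite: Kirby2010, Def. 4.3] -/
def dcl (C : Set K) : Set K :=
  {a | ∀ D ∈ eDer K C, D a = 0}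

/-- Membership in `dcl C`. [cite: Kirby2010, Def. 4.3] -/
theorem mem_dcl_iff {C : Set K} {a : K} : a ∈ dcl C ↔ ∀ D ∈ eDer K C, D a = 0 :=
  Iff.rfl

/-- `C ⊆ dcl C` (Kirby 2010, Lemma 4.4). [cite: Kirby2010, Lemma 4.4] -/
theorem subset_dcl (C : Set K) : C ⊆ dcl C :=
  fun _ hc _ hD => hD.2 _ hc

/-- `dcl` is monotone (Kirby 2010, Lemma 4.4). [cite: Kirby2010, Lemma 4.4] -/
theorem dcl_mono {B C : Set K} (h : B ⊆ C) : dcl B ⊆ dcl C :=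
  fun _ ha D hD => ha D (eDer_antitone h hD)

/-- An E-derivation vanishing on `C` vanishes on `dcl C`, i.e. `EDer(K/C) = EDer(K/dcl C)`.
[cite: Kirby2010, Lemma 4.4] -/
theorem eDer_dcl (C : Set K) : eDer K (dcl C) = eDer K C :=
  le_antisymm (eDer_antitone (subset_dcl C)) fun D hD => ⟨hD.1, fun _ ha => ha D hD⟩

/-- `dcl` is idempotent (Kirby 2010, Lemma 4.4). [cite: Kirby2010, Lemma 4.4] -/
theorem dcl_dcl (C : Set K) : dcl (dcl C) = dcl C := by
  ext a
  simp only [mem_dcl_iff, eDer_dcl]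

variable (K) in
/-- `dcl C` is (the carrier of) a subfield of `K` (Kirby 2010, Lemma 4.4: "the closure of any
subset is an E-subring, and, if `R` is a field, an E-subfield"): the common kernel of a family of
derivations is a subring, closed under inverses since `∂(x⁻¹) = -x⁻²∂x`.
[cite: Kirby2010, Lemma 4.4] -/
def dclSubfield (C : Set K) : Subfield K where
  carrier := dcl C
  mul_mem' {a b} ha hb D hD := by simp [Derivation.leibniz, ha D hD, hb D hD]
  one_mem' D _ := D.map_one_eq_zero
  add_mem' {a b} ha hb D hD := by simp [map_add, ha D hD, hb D hD]
  zero_mem' D _ := map_zero D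
  neg_mem' {a} ha D hD := by simp [map_neg, ha D hD]
  inv_mem' a ha D hD := by
    rcases eq_or_ne a 0 with rfl | ha0
    · simp
    · have h : D (a * a⁻¹) = 0 := by rw [mul_inv_cancel₀ ha0]; exact D.map_one_eq_zero
      rw [Derivation.leibniz, ha D hD, smul_zero, add_zero, smul_eq_mul] at h
      exact (mul_eq_zero.1 h).resolve_left ha0

/-- The carrier of `dclSubfield K C` is `dcl C`. [cite: Kirby2010, Lemma 4.4] -/
@[simp] theorem coe_dclSubfield (C : Set K) : (dclSubfield K C : Set K) = dcl C := rfl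

/-- Membership in `dclSubfield K C`. [cite: Kirby2010, Lemma 4.4] -/
@[simp] theorem mem_dclSubfield_iff {C : Set K} {a : K} : a ∈ dclSubfield K C ↔ a ∈ dcl C :=
  Iff.rfl

/-- `dcl C` is closed under `exp` (Kirby 2010, Lemma 4.4: an E-subfield): if every
E-derivation over `C` kills `a` then it kills `exp a = exp a · ∂a`. [cite: Kirby2010, Lemma 4.4] -/
theorem exp_mem_dcl {C : Set K} {a : K} (ha : a ∈ dcl C) : Literature.ModelTheory.ExponentialFields.ExponentialRing.exp a ∈ dcl C :=
  fun D hD => by rw [hD.1 a, ha D hD, mul_zero]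

omit [Literature.ModelTheory.ExponentialFields.ExponentialRing K] in
/-- A derivation vanishing on `C` vanishes on the subring generated by `C`. [folklore] -/
theorem derivation_eq_zero_of_mem_closure {C : Set K} {D : Derivation ℤ K K}
    (hD : ∀ c ∈ C, D c = 0) {a : K} (ha : a ∈ Subring.closure C) : D a = 0 := by
  induction ha using Subring.closure_induction with
  | mem x hx => exact hD x hx
  | zero => exact map_zero D
  | one => exact D.map_one_eq_zero
  | add x y _ _ hx hy => rw [map_add, hx, hy, add_zero]
  | neg x _ hx => rw [map_neg, hx, neg_zero]
  | mul x y _ _ hx hy => rw [Derivation.leibniz, hx, hy, smul_zero, smul_zero, add_zero]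

omit [Literature.ModelTheory.ExponentialFields.ExponentialRing K] in
/-- A derivation of `K` vanishing on a subring `S` is an `S`-derivation. [folklore] -/
def derivationOfSubring (S : Subring K) (D : Derivation ℤ K K) (hD : ∀ s ∈ S, D s = 0) :
    Derivation S K K where
  toFun := D
  map_add' := map_add D
  map_smul' s a := by
    show D (s • a) = s • D a
    rw [Subring.smul_def, Subring.smul_def, smul_eq_mul, smul_eq_mul, Derivation.leibniz,
      hD _ s.2, smul_zero, add_zero, smul_eq_mul]
  map_one_eq_zero' := D.map_one_eq_zero
  leibniz' a b := D.leibniz a b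

omit [Literature.ModelTheory.ExponentialFields.ExponentialRing K] in
/-- `derivationOfSubring` is the same function. [folklore] -/
@[simp] theorem derivationOfSubring_apply (S : Subring K) (D : Derivation ℤ K K)
    (hD : ∀ s ∈ S, D s = 0) (a : K) : derivationOfSubring S D hD a = D a := rfl

/-- The chain rule for exponential polynomials in the form `f(x, eˣ)`, `f ∈ S[X, Y]` a polynomial
over a subring `S` killed by the E-derivation `D`:
`D (f(x, eˣ)) = ∑ⱼ (∂f/∂Xⱼ + Yⱼ ∂f/∂Yⱼ)(x, eˣ) · D xⱼ`, i.e. with the formal derivative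
`Literature.NumberTheory.Transcendental.expPDeriv` of `ZilberField.lean` (Kirby 2010, Lemma 4.6). [cite: Kirby2010, Lemma 4.6] -/
theorem IsEDerivation.map_eval_expPolynomial {n : ℕ} {D : Derivation ℤ K K} (hE : IsEDerivation D)
    (S : Subring K) (hS : ∀ s ∈ S, D s = 0) (g : MvPolynomial (Fin n ⊕ Fin n) S) (x : Fin n → K) :
    D (eval (Sum.elim x (Literature.ModelTheory.ExponentialFields.ExponentialRing.exp ∘ x)) (map S.subtype g)) =
      ∑ j, eval (Sum.elim x (Literature.ModelTheory.ExponentialFields.ExponentialRing.exp ∘ x)) (expPDeriv j (map S.subtype g)) *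
        D (x j) := by
  set z : Fin n ⊕ Fin n → K := Sum.elim x (Literature.ModelTheory.ExponentialFields.ExponentialRing.exp ∘ x) with hz
  have hmap : ∀ p : MvPolynomial (Fin n ⊕ Fin n) S,
      eval z (map S.subtype p) = aeval (R := S) (S₁ := K) z p :=
    fun p => by rw [eval_map, aeval_def]; rfl
  have h := derivation_mvPolynomial_aeval (derivationOfSubring S D hS) z g
  rw [derivationOfSubring_apply, Fintype.sum_sum_type] at h
  rw [hmap, h, ← Finset.sum_add_distrib]
  refine Finset.sum_congr rfl fun j _ => ?_
  rw [derivationOfSubring_apply, derivationOfSubring_apply, smul_eq_mul, smul_eq_mul, expPDeriv,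
    pderiv_map, pderiv_map, map_add, map_mul, MvPolynomial.eval_X, hmap, hmap]
  have hj : D (z (Sum.inr j)) = Literature.ModelTheory.ExponentialFields.ExponentialRing.exp (x j) * D (x j) := hE (x j)
  rw [hj, show z (Sum.inl j) = x j from rfl, show z (Sum.inr j) = Literature.ModelTheory.ExponentialFields.ExponentialRing.exp (x j) from rfl]
  ring

/-- **Kirby 2010, Prop. 4.7: `ecl C ⊆ cl C`.** If `x` solves a Khovanskii system
`fᵢ(x, eˣ) = 0` over `C` with non-vanishing Jacobian `J`, and `∂` is an E-derivation vanishing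
on `C`, then `J · (∂xⱼ)ⱼ = 0` by the chain rule, so `∂xⱼ = 0` for all `j`.
[cite: Kirby2010, Prop. 4.7] -/
theorem ecl_subset_dcl (C : Set K) : ecl C ⊆ dcl C := by
  classical
  rintro a ⟨n, x, f, ⟨i₀, rfl⟩, hcoeff, heval, hdet⟩ D ⟨hE, hC⟩
  set S : Subring K := Subring.closure C
  have hS : ∀ s ∈ S, D s = 0 := fun s hs => derivation_eq_zero_of_mem_closure hC hs
  -- lift the polynomials to `S`
  have hlift : ∀ i, ∃ g : MvPolynomial (Fin n ⊕ Fin n) S, map S.subtype g = f i := by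
    intro i
    show f i ∈ Set.range (map S.subtype)
    rw [mem_range_map_iff_coeffs_subset]
    intro c hc
    obtain ⟨m, -, rfl⟩ := mem_coeffs_iff.mp (Finset.mem_coe.mp hc)
    exact ⟨⟨_, hcoeff i m⟩, rfl⟩
  choose g hg using hlift
  set z : Fin n ⊕ Fin n → K := Sum.elim x (Literature.ModelTheory.ExponentialFields.ExponentialRing.exp ∘ x)
  set J : Matrix (Fin n) (Fin n) K := Matrix.of fun i j => eval z (expPDeriv j (f i))
  have hJ : J.mulVec (fun j => D (x j)) = 0 := by
    ext i
    have h := hE.map_eval_expPolynomial S hS (g i) x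
    rw [hg, heval i, map_zero] at h
    rw [Matrix.mulVec, Pi.zero_apply, h]
    rfl
  have := Matrix.eq_zero_of_mulVec_eq_zero hdet hJ
  exact congr_fun this i₀

/-- `ecl`-closed sets need not a priori be `dcl`-closed, but `dcl`-closed sets are `ecl`-closed
(from Prop. 4.7). [cite: Kirby2010, Prop. 4.7] -/
theorem isEclClosed_of_dcl_subset {C : Set K} (h : dcl C ⊆ C) : IsEclClosed C :=
  isEclClosed_of_subset ((ecl_subset_dcl C).trans h)

end EDerivation

/-! ### Kirby's Prop. 7.1 (`cl ⊆ ecl`) as a named fact, and its consequences -/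

section Prop71

/-- **Kirby 2010, Prop. 7.1** ("If `F` is a partial E-field and `C` is a subset of `F` then
`cl^F(C) ⊆ ecl^F(C)`"; with Prop. 4.7 this is Thm. 1.1, `ecl^F = cl^F`), for a (total)
exponential field `K` of characteristic `0` (Kirby's standing convention for E-fields, §2; the
hypothesis matters: in characteristic `p` the exponential is trivial, every E-derivation is `0`
and `dcl C = K`): every element killed by all E-derivations over `C`
is a coordinate of a solution of a Khovanskii system over `C`. The printed proof uses the finite
character of `cl` (Prop. 4.5), the decomposition of strong extensions (Prop. 5.6), the extension
theorem for E-derivations along strong extensions (Thm. 6.3, resting on Ax 1971 Thm. 3 and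
Fact 6.4) and Lemma 4.8. Named fact (D-0014). [cite: Kirby2010, Prop. 7.1] -/
def Kirby2010_dcl_subset_ecl (K : Type*) [Field K] [CharZero K] [Literature.ModelTheory.ExponentialFields.ExponentialRing K] : Prop :=
  ∀ C : Set K, dcl C ⊆ ecl C

variable {K : Type*} [Field K] [CharZero K] [Literature.ModelTheory.ExponentialFields.ExponentialRing K]

/-- Kirby 2010, Thm. 1.1 (`ecl^F = cl^F`), from Prop. 4.7 (proved) and Prop. 7.1 (fact).
[cite: Kirby2010, Thm. 1.1] -/
theorem Kirby2010_dcl_subset_ecl.ecl_eq_dcl (h : Kirby2010_dcl_subset_ecl K) (C : Set K) :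
    ecl C = dcl C :=
  Set.Subset.antisymm (ecl_subset_dcl C) (h C)

/-- Under Prop. 7.1, `ecl` is idempotent (Kirby 2010, Lemma 3.3 / Thm. 1.1): discharges the fact
`Kirby2010_ecl_idem K` of `EclPregeometry.lean` conditionally. [cite: Kirby2010, Thm. 1.1] -/
theorem Kirby2010_dcl_subset_ecl.ecl_idem (h : Kirby2010_dcl_subset_ecl K) :
    Kirby2010_ecl_idem K := fun C => by
  rw [h.ecl_eq_dcl, h.ecl_eq_dcl, dcl_dcl]

/-- Under Prop. 7.1, every `ecl`-closed set is `dcl`-closed. [cite: Kirby2010, Thm. 1.1] -/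
theorem Kirby2010_dcl_subset_ecl.dcl_subset_of_isEclClosed (h : Kirby2010_dcl_subset_ecl K)
    {C : Set K} (hC : IsEclClosed C) : dcl C ⊆ C := by
  rw [← h.ecl_eq_dcl]
  exact hC.le

/-- Under Prop. 7.1, `ecl C` is an `exp`-closed subfield (Kirby 2010, Lemma 3.3 / Lemma 4.4):
discharges the fact `Kirby2010_ecl_isExpSubfield K` of `EclPregeometry.lean` conditionally.
[cite: Kirby2010, Lemma 4.4] -/
theorem Kirby2010_dcl_subset_ecl.ecl_isExpSubfield (h : Kirby2010_dcl_subset_ecl K) :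
    Kirby2010_ecl_isExpSubfield K := fun C =>
  ⟨⟨dclSubfield K C, by rw [coe_dclSubfield, h.ecl_eq_dcl]⟩,
    fun a ha => by rw [h.ecl_eq_dcl] at ha ⊢; exact exp_mem_dcl ha⟩

end Prop71

end Literature.NumberTheory.Transcendental
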